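import Summits.AtomisticToContinuum.Crystallization.Theorems.ChargedEnergyGapStencilChart
import HarnessLib

/-!
# ChargedEnergyGap · NODE 110B «FarkasKernel» — a generic ℚ certificate for "these linear rows imply that linear row" (door D5a, memo §10–§11)

decomp-a2c lens-3 g92 (generic; imports a tree file only for the ambient `ℝ`/`ℚ` library).

Door D5 («StationPolytope», memo CELLCHECKER-SPEC-g92 §10) reduces every census obligation to statements of ONE shape: a point `x` (the seven
depths, their squares, the six weights — any valuation `x : ℕ → ℝ`) satisfies finitely many linear rows `aⱼ·x ≤ bⱼ` with RATIONAL data, and one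
must conclude another linear row `a·x ≤ b` (a policy-feasibility facet `(B⁻¹W)ₖ ≥ 0`, a verdict `K·y·W ≤ capLB`, a bracket, or `0 ≤ −1` for an
EMPTY station).  The certificate is a sparse vector of non-negative multipliers `μ` with `Σ μⱼ a_{iⱼ} = a` and `Σ μⱼ b_{iⱼ} ≤ b` (Farkas); checking it
is exact rational arithmetic, so censuses batch by `decide +kernel` exactly as with NODE 108C.  (Rounded multipliers: emit the residual `a − Σ μⱼ a_{iⱼ}` onto the
variable-bound rows `±xₖ ≤ cₖ`, which every station polytope contains — then the form matches exactly and only `b` absorbs slack.)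

* `linAt a x i` — the linear form `Σₖ aₖ · x (i + k)` of a coefficient list; `LRow` = `(a, b)` meaning `linAt a x 0 ≤ b` (always spelled out; no `Prop`-valued def);
* `axpy`, `rowAt`, `combo`, `comboB` — `Σ μⱼ a_{iⱼ}` and `Σ μⱼ b_{iⱼ}` for SPARSE multipliers `[(i₁, μ₁), …]` (a basic dual solution has ≤ #vars + 1 non-zeros, so a
  certificate over 600 rows in 20 variables is ≈ 21 pairs); zero-padded lists, all STRUCTURAL recursion (kernel-reducible, no well-founded fix); an out-of-range index
  denotes the trivial row `0 ≤ 0`, so soundness needs no range check;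
* `sameForm` — two coefficient lists define the same linear form (equal up to trailing zeros);
* `FarkasCert`, `FarkasCert.check : Bool`, ★★ `FarkasCert.sound : c.check = true → (∀ r ∈ c.rows, linAt r.a x 0 ≤ r.b) → linAt c.target.a x 0 ≤ c.target.b`;
* `FarkasCert.infeasible` — the emptiness corollary (target `([], b)` with `b < 0`: no valuation satisfies all rows).

No analysis, no placeholders; ≈ 40 lines of list algebra and one induction.

[SPLIT beneath (T¹ᶜ) (no EQUIV introduced) · generic kernel for D5 forms F and G · UNDECIDED(test = (D¹)) unchanged.] -/

namespace Summit.AtomisticToContinuum.Crystallization.Theorems.ChargedEnergyGapChartDial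

/-! ## §110B.1 Linear forms on coefficient lists -/
section LinearForms

/-- The linear form of a rational coefficient list at a real valuation `x`, reading variables from index `i` on:
`linAt [c₀, c₁, …] x i = c₀·x i + c₁·x (i+1) + …`. -/
def linAt : List ℚ → (ℕ → ℝ) → ℕ → ℝ
  | [], _, _ => 0
  | c :: cs, x, i => (c : ℝ) * x i + linAt cs x (i + 1)

/-- [formal bookkeeping] `linAt [] x i = 0`. -/
@[simp] theorem linAt_nil (x : ℕ → ℝ) (i : ℕ) : linAt [] x i = 0 := rfl

/-- [formal bookkeeping] `linAt (c :: cs) x i = c·x i + linAt cs x (i+1)`. -/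
@[simp] theorem linAt_cons (c : ℚ) (cs : List ℚ) (x : ℕ → ℝ) (i : ℕ) :
    linAt (c :: cs) x i = (c : ℝ) * x i + linAt cs x (i + 1) := rfl

/-- A linear row with rational data: coefficients `a` and bound `b`, meaning `linAt a x 0 ≤ b`. -/
structure LRow where
  /-- coefficients of the variables `x 0, x 1, …` -/
  a : List ℚ
  /-- right-hand side -/
  b : ℚ

/-- `axpy μ a acc = μ·a + acc` on coefficient lists, the shorter list padded with zeros (structural recursion on `a`). -/
def axpy (μ : ℚ) : List ℚ → List ℚ → List ℚ
  | [], acc => acc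
  | c :: cs, [] => (μ * c) :: axpy μ cs []
  | c :: cs, d :: ds => (μ * c + d) :: axpy μ cs ds

/-- `axpy` is `μ·a + acc` as linear forms. -/
theorem linAt_axpy (μ : ℚ) (a acc : List ℚ) (x : ℕ → ℝ) (i : ℕ) :
    linAt (axpy μ a acc) x i = (μ : ℝ) * linAt a x i + linAt acc x i := by
  induction a generalizing acc i with
  | nil => simp [axpy]
  | cons c cs ih =>
    cases acc with
    | nil => simp only [axpy, linAt_cons, linAt_nil, ih]; push_cast; ring
    | cons d ds => simp only [axpy, linAt_cons, ih]; push_cast; ring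

/-- The `i`-th row of a list, the trivial row `([], 0)` (i.e. `0 ≤ 0`) when out of range. -/
def rowAt (rs : List LRow) (i : ℕ) : LRow := rs.getD i ⟨[], 0⟩

/-- Whatever holds for every listed row holds for `rowAt rs i` (the default row holds trivially). -/
theorem rowAt_holds {rs : List LRow} {x : ℕ → ℝ} (h : ∀ r ∈ rs, linAt r.a x 0 ≤ (r.b : ℝ)) (i : ℕ) :
    linAt (rowAt rs i).a x 0 ≤ ((rowAt rs i).b : ℝ) := by
  induction rs generalizing i with
  | nil => simp [rowAt]
  | cons r rs ih =>
    cases i with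
    | zero => simpa [rowAt] using h r (by simp)
    | succ j => simpa [rowAt] using ih (fun r' hr' => h r' (by simp [hr'])) j

/-- `Σⱼ μⱼ·a_{iⱼ}` for sparse multipliers `(iⱼ, μⱼ)` over the rows `rs`. -/
def combo (rs : List LRow) : List (ℕ × ℚ) → List ℚ
  | [] => []
  | (i, μ) :: ms => axpy μ (rowAt rs i).a (combo rs ms)

/-- `Σⱼ μⱼ·b_{iⱼ}` for the same sparse multipliers. -/
def comboB (rs : List LRow) : List (ℕ × ℚ) → ℚ
  | [] => 0
  | (i, μ) :: ms => μ * (rowAt rs i).b + comboB rs ms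

/-- All entries of a rational list are zero. -/
def isZeroList : List ℚ → Bool
  | [] => true
  | c :: cs => decide (c = 0) && isZeroList cs

/-- Two coefficient lists define the same linear form (equal after zero padding). Structural on the first list. -/
def sameForm : List ℚ → List ℚ → Bool
  | [], v => isZeroList v
  | c :: cs, [] => decide (c = 0) && sameForm cs []
  | c :: cs, d :: ds => decide (c = d) && sameForm cs ds

/-- A zero list is the zero form. -/
theorem linAt_of_isZeroList {u : List ℚ} (h : isZeroList u = true) (x : ℕ → ℝ) (i : ℕ) : linAt u x i = 0 := by
  induction u generalizing i with
  | nil => rfl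
  | cons c cs ih =>
    simp only [isZeroList, Bool.and_eq_true, decide_eq_true_eq] at h
    simp [h.1, ih h.2]

/-- `sameForm u v` ⇒ equal linear forms. -/
theorem linAt_eq_of_sameForm {u v : List ℚ} (h : sameForm u v = true) (x : ℕ → ℝ) (i : ℕ) : linAt u x i = linAt v x i := by
  induction u generalizing v i with
  | nil => simp only [sameForm] at h; rw [linAt_nil, linAt_of_isZeroList h]
  | cons c cs ih =>
    cases v with
    | nil =>
      simp only [sameForm, Bool.and_eq_true, decide_eq_true_eq] at h
      rw [linAt_cons, linAt_nil, h.1, ih h.2]; simp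
    | cons d ds =>
      simp only [sameForm, Bool.and_eq_true, decide_eq_true_eq] at h
      rw [linAt_cons, linAt_cons, h.1, ih h.2]

/-- All (sparse) multipliers are non-negative. -/
def nonnegAll : List (ℕ × ℚ) → Bool
  | [] => true
  | (_, μ) :: ms => decide (0 ≤ μ) && nonnegAll ms

/-- The heart of Farkas soundness: a non-negative combination of valid rows is valid. -/
theorem linAt_combo_le (x : ℕ → ℝ) (rs : List LRow) (hrs : ∀ r ∈ rs, linAt r.a x 0 ≤ (r.b : ℝ)) :
    ∀ ms : List (ℕ × ℚ), nonnegAll ms = true → linAt (combo rs ms) x 0 ≤ (comboB rs ms : ℝ)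
  | [], _ => by simp [combo, comboB]
  | (i, μ) :: ms, hμ => by
    simp only [nonnegAll, Bool.and_eq_true, decide_eq_true_eq] at hμ
    have hr := rowAt_holds hrs i
    have ih := linAt_combo_le x rs hrs ms hμ.2
    simp only [combo, comboB, linAt_axpy]
    push_cast
    have hμ0 : (0 : ℝ) ≤ (μ : ℝ) := by exact_mod_cast hμ.1
    nlinarith [mul_le_mul_of_nonneg_left hr hμ0]

end LinearForms

/-! ## §110B.2 The certificate -/
section Certificate

/-- A FARKAS CERTIFICATE: rows `rows` (hypotheses), sparse non-negative multipliers `mu = [(i, μᵢ), …]` and the `target` row to be derived. -/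
structure FarkasCert where
  /-- the hypothesis rows `aⱼ·x ≤ bⱼ` -/
  rows : List LRow
  /-- the sparse multipliers `(row index, μ ≥ 0)` -/
  mu : List (ℕ × ℚ)
  /-- the conclusion `a·x ≤ b` -/
  target : LRow

/-- The Boolean check: `μ ≥ 0`, `Σ μⱼ aⱼ` is the target form, and `Σ μⱼ bⱼ ≤ b`. -/
def FarkasCert.check (c : FarkasCert) : Bool :=
  nonnegAll c.mu && sameForm (combo c.rows c.mu) c.target.a && decide (comboB c.rows c.mu ≤ c.target.b)

/-- ★★ **FARKAS SOUNDNESS**: a checked certificate turns the hypothesis rows (at any real valuation) into the target row. -/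
theorem FarkasCert.sound (c : FarkasCert) (h : c.check = true) (x : ℕ → ℝ)
    (hrows : ∀ r ∈ c.rows, linAt r.a x 0 ≤ (r.b : ℝ)) : linAt c.target.a x 0 ≤ (c.target.b : ℝ) := by
  simp only [FarkasCert.check, Bool.and_eq_true, decide_eq_true_eq] at h
  obtain ⟨⟨hμ, hsame⟩, hb⟩ := h
  have h1 := linAt_combo_le x c.rows hrows c.mu hμ
  have h2 := linAt_eq_of_sameForm hsame x 0
  have hb' : (comboB c.rows c.mu : ℝ) ≤ (c.target.b : ℝ) := by exact_mod_cast hb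
  linarith

/-- Batch form: every certificate of a checked list is sound. -/
theorem FarkasCert.sound_of_all {cs : List FarkasCert} (h : cs.all FarkasCert.check = true) {c : FarkasCert} (hc : c ∈ cs)
    (x : ℕ → ℝ) (hrows : ∀ r ∈ c.rows, linAt r.a x 0 ≤ (r.b : ℝ)) : linAt c.target.a x 0 ≤ (c.target.b : ℝ) :=
  c.sound (List.all_eq_true.1 h c hc) x hrows

/-- **EMPTINESS**: a checked certificate whose target is the zero form with a negative bound shows that NO valuation satisfies all rows
(the polytope is empty — this is the polytope version of NODE 109B's closed-form empty cell). -/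
theorem FarkasCert.infeasible (c : FarkasCert) (h : c.check = true) (hz : isZeroList c.target.a = true) (hb : c.target.b < 0)
    (x : ℕ → ℝ) (hrows : ∀ r ∈ c.rows, linAt r.a x 0 ≤ (r.b : ℝ)) : False := by
  have ht := c.sound h x hrows
  rw [linAt_of_isZeroList hz] at ht
  have : ((c.target.b : ℚ) : ℝ) < 0 := by exact_mod_cast hb
  linarith

end Certificate

end Summit.AtomisticToContinuum.Crystallization.Theorems.ChargedEnergyGapChartDial
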